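import Summits.QuantumFields.YangMills.Theses.FradkinShenkerFlow
import Literature.MathematicalPhysics.QuantumFieldTheory.BalabanSoftAveraging
import Literature.MathematicalPhysics.QuantumFieldTheory.LatticeGaugeProofs

/-!
# Stub `stub_jointMarginal` (A1) of the line `rg-variance-cascade` (crux `SusceptibilityToPoincare`)

(Variant with the `:=`-free signature: `wilsonMeasure (d := 4) (L := 2 * S + 1) r.ρ β` is written as the
type ascription `(wilsonMeasure r.ρ β : Measure (GaugeConfig 4 (2 * S + 1) G))`, the same term.)

Route `FradkinShenkerFlow` of `YangMills`, crux item `stmt-QuantumFields-9441`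
(`Summit.QuantumFields.YangMills.Theses.FradkinShenkerFlow.SusceptibilityToPoincare`, FS ⇒ UP),
registered skeleton `Cruxes/SusceptibilityToPoincare/Lines/rg_variance_cascade.lean`, stub A1:
**the joint law of the fine Wilson field and its von Mises–Fisher-smeared block fields is a
probability measure whose fine marginal is the Wilson measure.**

For the 4D torus of side `2S+1`, the Wilson measure `μ = wilsonMeasure r.ρ β` on
`GaugeConfig 4 (2S+1) G`, a block base `b ≥ 1`, a number of levels `n`, a pin strength `s` and
the product `π = ⊗_k ⊗_e Haar` of Haar probability measures over all coarse links of all levels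
`k < n` (level `k` lives on the block torus of side `blockSide (2S+1) b^(k+1)`), the joint law is

  `P = (μ ⊗ π).tilted Φ`,  `Φ(U, V) = Σ_k Σ_e s · Re tr r.ρ (V^k_e · h_{k,e}(U)⁻¹)`,

where `h_{k,e}(U) = BalabanAveraging.link (2S+1) b^(k+1) (BlockMean.rep 0) U e` is the straight
transporter between consecutive block corners (a measurable function of `U`).  We prove
`IsProbabilityMeasure P` and `P.map Prod.fst = μ`.

## Proof

The whole statement is an instance of an abstract fact about tilts of product measures along a
fibrewise measure-preserving shear (`JointMarginal.map_fst_tilted_prod_shear`): let `μ`, `π` be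
probability measures on `X`, `Y`, let `g : X → Y → Y` be jointly measurable with
`π.map (g x) = π` for every `x`, and let `ψ : Y → ℝ` be measurable and bounded above.  Then the
skew product `T(x, y) = (x, g x y)` preserves `μ ⊗ π` (`MeasurePreserving.skew_product`), the
tilt `Φ = ψ ∘ snd ∘ T` has `exp Φ` integrable (bounded), so `(μ ⊗ π).tilted Φ` is a probability
measure (`isProbabilityMeasure_tilted`); and since `fst ∘ T = fst`,

  `((μ ⊗ π).tilted Φ).map fst = (((μ ⊗ π).tilted (ψ ∘ snd ∘ T)).map T).map fst
     = ((μ ⊗ π).tilted (ψ ∘ snd)).map fst            (push-forward of a pulled-back density,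
                                                       `JointMarginal.map_tilted_comp`)
     = (μ ⊗ π.tilted ψ).map fst = μ`                  (`prod_withDensity_right`, `Measure.fst_prod`).

In the application `g U V = (k, e) ↦ V^k_e · h_{k,e}(U)⁻¹` is measurable
(`BalabanAveraging.measurable_link`; `MeasurableMul₂ G`, `MeasurableInv G` from the second
countability of `G` forced by the faithful representation `r`) and preserves `π` coordinatewise by
RIGHT invariance of the Haar probability measure of the compact group
(`haarProbability.instIsMulRightInvariant`, `measurePreserving_pi` twice), and
`ψ(V) = Σ_k Σ_e s · Re tr r.ρ (V^k_e)` is continuous in each coordinate and bounded by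
`Σ_k Σ_e |s| · sup |Re tr r.ρ|` (`exists_bound_trace_re_nonneg`).  The Wilson measure is a
probability measure by `isProbabilityMeasure_wilsonMeasure`.
-/

noncomputable section

open MeasureTheory ProbabilityTheory
open Literature.MathematicalPhysics.QuantumFieldTheory

namespace Summit.QuantumFields.YangMills.Theorems.SusceptibilityToPoincare.RgVarianceCascade

namespace JointMarginal

/-! ### Abstract measure theory: tilting a product along a fibrewise measure-preserving shear -/

section Abstract

variable {X Y : Type*} [MeasurableSpace X] [MeasurableSpace Y]

/-- **Push-forward of a pulled-back density**: for measurable `T : X → Y` and a measurable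
density `d` on `Y`, `(μ.withDensity (d ∘ T)).map T = (μ.map T).withDensity d`. [folklore] -/
theorem map_withDensity_comp {μ : Measure X} {T : X → Y} (hT : Measurable T) {d : Y → ENNReal}
    (hd : Measurable d) : (μ.withDensity fun x => d (T x)).map T = (μ.map T).withDensity d := by
  ext s hs
  rw [Measure.map_apply hT hs, withDensity_apply _ (hT hs), withDensity_apply _ hs,
    Measure.restrict_map hT hs, lintegral_map hd hT]

/-- **Push-forward of a pulled-back tilt** along a measure-preserving map: if `T` pushes `μ`
to `ν` and `ψ` is measurable, then `(μ.tilted (ψ ∘ T)).map T = ν.tilted ψ` (the normalisations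
agree because `∫ exp (ψ ∘ T) dμ = ∫ exp ψ dν`). [folklore] -/
theorem map_tilted_comp {μ : Measure X} {ν : Measure Y} {T : X → Y}
    (hT : MeasurePreserving T μ ν) {ψ : Y → ℝ} (hψ : Measurable ψ) :
    (μ.tilted fun x => ψ (T x)).map T = ν.tilted ψ := by
  have hsm : StronglyMeasurable fun y => Real.exp (ψ y) :=
    (Real.measurable_exp.comp hψ).stronglyMeasurable
  have hint : ∫ x, Real.exp (ψ (T x)) ∂μ = ∫ y, Real.exp (ψ y) ∂ν := by
    rw [← hT.map_eq, integral_map_of_stronglyMeasurable hT.measurable hsm]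
  simp only [Measure.tilted, hint]
  set Z := ∫ y, Real.exp (ψ y) ∂ν
  rw [← hT.map_eq]
  exact map_withDensity_comp hT.measurable (d := fun y => ENNReal.ofReal (Real.exp (ψ y) / Z))
    ((Real.measurable_exp.comp hψ).div_const Z).ennreal_ofReal

/-- **Tilting a product of probability measures by a function of the second coordinate** tilts
the second factor: `(μ ⊗ π).tilted (ψ ∘ snd) = μ ⊗ (π.tilted ψ)`. [folklore] -/
theorem tilted_prod_snd (μ : Measure X) (π : Measure Y) [IsProbabilityMeasure μ] [SFinite π]
    {ψ : Y → ℝ} (hψ : Measurable ψ) :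
    (μ.prod π).tilted (fun ω : X × Y => ψ ω.2) = μ.prod (π.tilted ψ) := by
  simp only [Measure.tilted]
  rw [integral_fun_snd (μ := μ) (ν := π) (fun y => Real.exp (ψ y)), probReal_univ, one_smul]
  exact (prod_withDensity_right
    ((Real.measurable_exp.comp hψ).div_const _).ennreal_ofReal).symm

/-- **Fine marginal of a product tilted along a fibrewise measure-preserving shear.**  Let `μ`,
`π` be probability measures, `g : X → Y → Y` jointly measurable with `π.map (g x) = π` for all
`x`, and `ψ : Y → ℝ` measurable and bounded above.  Then `(μ ⊗ π).tilted ((x, y) ↦ ψ (g x y))`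
is a probability measure and its image under `Prod.fst` is `μ`: the skew product
`T (x, y) = (x, g x y)` preserves `μ ⊗ π`, carries the tilt to `ψ ∘ snd`, and fixes `fst`.
[folklore] -/
theorem map_fst_tilted_prod_shear {μ : Measure X} {π : Measure Y} [IsProbabilityMeasure μ]
    [IsProbabilityMeasure π] {g : X → Y → Y} (hgm : Measurable (Function.uncurry g))
    (hg : ∀ x, π.map (g x) = π) {ψ : Y → ℝ} (hψm : Measurable ψ) {C : ℝ} (hψC : ∀ y, ψ y ≤ C) :
    IsProbabilityMeasure ((μ.prod π).tilted fun ω => ψ (g ω.1 ω.2)) ∧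
      ((μ.prod π).tilted fun ω => ψ (g ω.1 ω.2)).map Prod.fst = μ := by
  -- the skew product preserves the product measure
  have hT : MeasurePreserving (fun ω : X × Y => (ω.1, g ω.1 ω.2)) (μ.prod π) (μ.prod π) :=
    (MeasurePreserving.id μ).skew_product hgm (ae_of_all _ hg)
  have hexpm : Measurable fun y => Real.exp (ψ y) := Real.measurable_exp.comp hψm
  -- the tilts are bounded, hence integrable
  have hψi : Integrable (fun y => Real.exp (ψ y)) π :=
    Integrable.of_bound hexpm.aestronglyMeasurable (Real.exp C) (ae_of_all _ fun y => by
      rw [Real.norm_eq_abs, Real.abs_exp]; exact Real.exp_le_exp.2 (hψC y))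
  have hΦi : Integrable (fun ω : X × Y => Real.exp (ψ (g ω.1 ω.2))) (μ.prod π) :=
    Integrable.of_bound (hexpm.comp hgm).aestronglyMeasurable (Real.exp C)
      (ae_of_all _ fun ω => by
        rw [Real.norm_eq_abs, Real.abs_exp]; exact Real.exp_le_exp.2 (hψC _))
  refine ⟨isProbabilityMeasure_tilted hΦi, ?_⟩
  have key : (((μ.prod π).tilted fun ω => ψ (g ω.1 ω.2)).map fun ω : X × Y => (ω.1, g ω.1 ω.2)) =
      (μ.prod π).tilted fun ω : X × Y => ψ ω.2 :=
    map_tilted_comp hT (ψ := fun ω : X × Y => ψ ω.2) (hψm.comp measurable_snd)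
  haveI := isProbabilityMeasure_tilted hψi
  calc ((μ.prod π).tilted fun ω => ψ (g ω.1 ω.2)).map Prod.fst
      = (((μ.prod π).tilted fun ω => ψ (g ω.1 ω.2)).map
          fun ω : X × Y => (ω.1, g ω.1 ω.2)).map Prod.fst :=
        (Measure.map_map measurable_fst hT.measurable).symm
    _ = (μ.prod (π.tilted ψ)).map Prod.fst := by rw [key, tilted_prod_snd μ π hψm]
    _ = μ := Measure.fst_prod

end Abstract

/-! ### The torus: the shear by the straight transporters and the level sum -/

section Torus

variable {G : Type} [Group G] [TopologicalSpace G] [IsTopologicalGroup G] [CompactSpace G]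
  [MeasurableSpace G] [BorelSpace G]

omit [CompactSpace G] in
/-- The shear `(U, V) ↦ (k, e) ↦ V^k_e · h_{k,e}(U)⁻¹` by the straight transporters of the fine
field is jointly measurable. [folklore] -/
theorem measurable_shear [SecondCountableTopology G] (S b n : ℕ) [NeZero b] :
    Measurable fun ω : GaugeConfig 4 (2 * S + 1) G ×
        ((k : Fin n) → GaugeConfig 4 (BalabanAveraging.blockSide (2 * S + 1) (b ^ ((k : ℕ) + 1))) G) =>
      fun (k : Fin n) (e : Edge 4 (BalabanAveraging.blockSide (2 * S + 1) (b ^ ((k : ℕ) + 1)))) =>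
        ω.2 k e * (BalabanAveraging.link (2 * S + 1) (b ^ ((k : ℕ) + 1))
          (BalabanAveraging.BlockMean.rep 0) ω.1 e)⁻¹ := by
  refine measurable_pi_lambda _ fun k => measurable_pi_lambda _ fun e => ?_
  have hl := BalabanAveraging.measurable_link (d := 4) (N := 2 * S + 1) (b := b ^ ((k : ℕ) + 1))
    (G := G) (BalabanAveraging.BlockMean.rep 0)
  fun_prop

/-- For a fixed fine field the shear preserves the product Haar measure of the coarse links
(right invariance of the Haar probability measure of the compact group, coordinatewise).
[folklore] -/
theorem map_shear_pi (S b n : ℕ) [NeZero b] (U : GaugeConfig 4 (2 * S + 1) G) :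
    (Measure.pi fun k : Fin n => Measure.pi
        fun _ : Edge 4 (BalabanAveraging.blockSide (2 * S + 1) (b ^ ((k : ℕ) + 1))) =>
          haarProbability G).map
      (fun (V : (k : Fin n) →
          GaugeConfig 4 (BalabanAveraging.blockSide (2 * S + 1) (b ^ ((k : ℕ) + 1))) G)
        (k : Fin n) (e : Edge 4 (BalabanAveraging.blockSide (2 * S + 1) (b ^ ((k : ℕ) + 1)))) =>
        V k e * (BalabanAveraging.link (2 * S + 1) (b ^ ((k : ℕ) + 1))
          (BalabanAveraging.BlockMean.rep 0) U e)⁻¹) =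
    Measure.pi fun k : Fin n => Measure.pi
      fun _ : Edge 4 (BalabanAveraging.blockSide (2 * S + 1) (b ^ ((k : ℕ) + 1))) =>
        haarProbability G :=
  (measurePreserving_pi
    (fun k : Fin n => Measure.pi
      fun _ : Edge 4 (BalabanAveraging.blockSide (2 * S + 1) (b ^ ((k : ℕ) + 1))) =>
        haarProbability G)
    (fun k : Fin n => Measure.pi
      fun _ : Edge 4 (BalabanAveraging.blockSide (2 * S + 1) (b ^ ((k : ℕ) + 1))) =>
        haarProbability G)
    (f := fun (k : Fin n)
        (W : GaugeConfig 4 (BalabanAveraging.blockSide (2 * S + 1) (b ^ ((k : ℕ) + 1))) G)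
        (e : Edge 4 (BalabanAveraging.blockSide (2 * S + 1) (b ^ ((k : ℕ) + 1)))) =>
      W e * (BalabanAveraging.link (2 * S + 1) (b ^ ((k : ℕ) + 1))
        (BalabanAveraging.BlockMean.rep 0) U e)⁻¹)
    fun k => measurePreserving_pi (fun _ => haarProbability G) (fun _ => haarProbability G)
      (f := fun (e : Edge 4 (BalabanAveraging.blockSide (2 * S + 1) (b ^ ((k : ℕ) + 1))))
          (x : G) =>
        x * (BalabanAveraging.link (2 * S + 1) (b ^ ((k : ℕ) + 1))
          (BalabanAveraging.BlockMean.rep 0) U e)⁻¹)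
      fun _ => measurePreserving_mul_right (haarProbability G) _).map_eq

omit [IsTopologicalGroup G] [CompactSpace G] [MeasurableSpace G] [BorelSpace G] in
/-- The level sum `ψ(V) = Σ_k Σ_e s · Re tr r.ρ (V^k_e)` is bounded above by
`Σ_k Σ_e |s| · B` for any bound `B` on `|Re tr r.ρ|`. [folklore] -/
theorem levelSum_le (r : LatticeRep G) (b n : ℕ) [NeZero b] (s : ℝ) (S : ℕ) {B : ℝ}
    (hB : ∀ g : G, |((r.ρ g).trace).re| ≤ B)
    (V : (k : Fin n) → GaugeConfig 4 (BalabanAveraging.blockSide (2 * S + 1) (b ^ ((k : ℕ) + 1))) G) :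
    ∑ k : Fin n, ∑ e : Edge 4 (BalabanAveraging.blockSide (2 * S + 1) (b ^ ((k : ℕ) + 1))),
        s * (r.ρ (V k e)).trace.re ≤
      ∑ k : Fin n, ∑ _e : Edge 4 (BalabanAveraging.blockSide (2 * S + 1) (b ^ ((k : ℕ) + 1))),
        |s| * B :=
  Finset.sum_le_sum fun k _ => Finset.sum_le_sum fun e _ =>
    (le_abs_self _).trans (by
      rw [abs_mul]
      exact mul_le_mul_of_nonneg_left (hB _) (abs_nonneg s))

omit [IsTopologicalGroup G] [CompactSpace G] in
/-- The level sum is measurable (product σ-algebras; `r.ρ` continuous). [folklore] -/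
theorem measurable_levelSum (r : LatticeRep G) (b n : ℕ) [NeZero b] (s : ℝ) (S : ℕ) :
    Measurable fun V : (k : Fin n) →
        GaugeConfig 4 (BalabanAveraging.blockSide (2 * S + 1) (b ^ ((k : ℕ) + 1))) G =>
      ∑ k : Fin n, ∑ e : Edge 4 (BalabanAveraging.blockSide (2 * S + 1) (b ^ ((k : ℕ) + 1))),
        s * (r.ρ (V k e)).trace.re := by
  refine Finset.measurable_sum _ fun k _ => Finset.measurable_sum _ fun e _ => ?_
  exact measurable_const.mul ((continuous_trace_re r.ρ r.continuous).measurable.comp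
    ((measurable_pi_apply e).comp (measurable_pi_apply k)))

end Torus

end JointMarginal

/-! ### The registered stub -/

/-- `stub_jointMarginal` — **A1, the fine marginal of the joint law is the Wilson measure**.
For EVERY compact `G`, lattice representation `r`, real `β`, block base `b ≥ 1`, `n`, `s` and
side `2S+1`: the joint law `P = (μ_{β,S} ⊗ Haar^{⊗coarse}).tilted(Σ_k Σ_e s Re tr ρ(V^k_e (link U e)⁻¹))`
is a probability measure and its image under `Prod.fst` is `μ_{β,S}`.  Instance of
`JointMarginal.map_fst_tilted_prod_shear` with the shear by the straight transporters
(`JointMarginal.measurable_shear`, `JointMarginal.map_shear_pi`: right invariance of Haar) and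
the bounded measurable level sum (`JointMarginal.levelSum_le`, `JointMarginal.measurable_levelSum`);
`μ_{β,S}` is a probability measure by `isProbabilityMeasure_wilsonMeasure`. [folklore] -/
theorem stub_jointMarginal :
    ∀ (G : Type) [Group G] [TopologicalSpace G] [IsTopologicalGroup G] [CompactSpace G]
      [MeasurableSpace G] [BorelSpace G] (r : LatticeRep G) (β : ℝ) (b : ℕ) [NeZero b] (n : ℕ) (s : ℝ) (S : ℕ)
      (P : Measure (GaugeConfig 4 (2 * S + 1) G ×
          ((k : Fin n) → GaugeConfig 4 (BalabanAveraging.blockSide (2 * S + 1) (b ^ ((k : ℕ) + 1))) G))),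
      P = ((wilsonMeasure r.ρ β : Measure (GaugeConfig 4 (2 * S + 1) G)).prod
          (Measure.pi fun k : Fin n => Measure.pi
            fun _ : Edge 4 (BalabanAveraging.blockSide (2 * S + 1) (b ^ ((k : ℕ) + 1))) => haarProbability G)).tilted
          (fun ω => ∑ k : Fin n, ∑ e : Edge 4 (BalabanAveraging.blockSide (2 * S + 1) (b ^ ((k : ℕ) + 1))),
            s * (r.ρ (ω.2 k e * (BalabanAveraging.link (2 * S + 1) (b ^ ((k : ℕ) + 1))
              (BalabanAveraging.BlockMean.rep 0) ω.1 e)⁻¹)).trace.re) →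
      IsProbabilityMeasure P ∧
        P.map Prod.fst = (wilsonMeasure r.ρ β : Measure (GaugeConfig 4 (2 * S + 1) G)) := by
  intro G _ _ _ _ _ _ r β b _ n s S P hP
  subst hP
  haveI : SecondCountableTopology G :=
    (r.continuous.isClosedEmbedding r.injective).isEmbedding.secondCountableTopology
  haveI := isProbabilityMeasure_wilsonMeasure (d := 4) (L := 2 * S + 1) (G := G) r.ρ r.continuous β
  obtain ⟨B, -, hB⟩ := exists_bound_trace_re_nonneg r.ρ r.continuous
  exact JointMarginal.map_fst_tilted_prod_shear
    (g := fun (U : GaugeConfig 4 (2 * S + 1) G)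
        (V : (k : Fin n) →
          GaugeConfig 4 (BalabanAveraging.blockSide (2 * S + 1) (b ^ ((k : ℕ) + 1))) G)
        (k : Fin n) (e : Edge 4 (BalabanAveraging.blockSide (2 * S + 1) (b ^ ((k : ℕ) + 1)))) =>
      V k e * (BalabanAveraging.link (2 * S + 1) (b ^ ((k : ℕ) + 1))
        (BalabanAveraging.BlockMean.rep 0) U e)⁻¹)
    (JointMarginal.measurable_shear S b n) (JointMarginal.map_shear_pi S b n)
    (ψ := fun V => ∑ k : Fin n,
        ∑ e : Edge 4 (BalabanAveraging.blockSide (2 * S + 1) (b ^ ((k : ℕ) + 1))),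
          s * (r.ρ (V k e)).trace.re)
    (JointMarginal.measurable_levelSum r b n s S) (JointMarginal.levelSum_le r b n s S hB)

end Summit.QuantumFields.YangMills.Theorems.SusceptibilityToPoincare.RgVarianceCascade

end
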